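import Mathlib
import HarnessLib
import HarnessLib.Audit
import Summits.PneNP.Statement
import Literature.Computability.Complexity.Circuit
import Literature.Computability.Complexity.CircuitClasses
import Literature.Computability.Complexity.Nondeterministic
import Literature.Computability.Complexity.NPBridge
import Literature.Computability.Complexity.CircuitClassesUniformProofs
import HarnessLib.Audit.Status.Attr

/-!
Route: PositionalGames

DORMANT since 2026-08-22T03:22:26Z (reconciler: no traction for 5 d (last activity item-evidence-added at 2026-08-17T02:12:13Z); parked, not closed — `ledger route dormant route-PneNP-PositionalGames --off` to reactivate) — unstaffed, not closed; items shared with open routes are served there. `ledger route dormant <id> --off` reactivates.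

# Route PneNP/PositionalGames — "Are parity games a monotone problem?" (idea card
positional-games-monotone-complexity)

## Thesis X (it suffices to show)
Words: deciding the winner of a MEAN-PAYOFF GAME is not computable by polynomial-size Boolean
circuits
(function-level "MPG ∉ P/poly"). Games are not yet defined in the tree, so every statement INLINES
them:
a template on `Fin n` is an owner map `o : Fin n → Bool` (`true` = Even/Max) and a start vertex `v`
(parity: also priorities `p : Fin n → ℕ`); the INPUT is `x : Fin n × Fin n → Bool` (bit `(u,w)` =
"edge u→w
present" if `o u = true`, = "edge u→w ABSENT" if `o u = false`, so winning is MONOTONE in `x`), for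
mean
payoff additionally `n` binary digits per vertex weight (`Sum.inr (u,j)`), weights in `[0,2^n)`,
threshold
mean ≥ 2^(n-1). "Even wins from v" := ∃ positional σ legal for Even, ∀ positional τ legal for Odd,
the
cycle of the lasso from `v` under (σ,τ) has even maximal priority (resp. mean weight ≥ 2^(n-1)); by
positional determinacy (Ehrenfeucht–Mycielski, Emerson–Jutla, doi:10.1016/s0304-3975(03)00427-4)
this IS
the winning region on dead-end-free inputs, and in general it equals NoEvenDeadEnd ∧ (SomeOddDeadEnd
∨ W).
Lean (route decl `MpgGeneralSuperpoly`, constants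
`Literature.Computability.Complexity.circuitSizeOver`,
`.B2`): ∀ k, ∃ᶠ n in atTop, ∃ (o : Fin n → Bool) (v : Fin n), n ^ k < circuitSizeOver B2 (MPGWIN n o
v).

## Assembly X → PneNP
`MpgGeneralSuperpoly → MpgHardNpLanguage → PneNP`, where the support item MpgHardNpLanguage
CONSTRUCTS an
NP language (games with the owner bits in the input) that is non-uniformly as hard as every
template;
then NP ⊆ P would give (P_bool_eq_holds, NP_bool_eq_holds, P_subset_PPoly_holds — all PROVED cone
facts)
polynomial circuits for every template, contradicting X. Elementary given the two hypotheses
(checked in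
the planner's Sketch.lean).

## The line (two layers; cruxes first, glue later)
Monotone lower bounds are the one regime where superpolynomial bounds for explicit functions — even
functions in P — are THEOREMS (Razborov1985b, Tardos1988). Positional games give monotone functions
in
NP ∩ coNP whose every known algorithm (attractors, progress measures, strategy improvement,
separating
automata, quasi-dominions) is a monotone fixed-point iteration, and whose algorithmic barrier is a
theorem with an exact value: universal trees, n^{lg(h/lg n) - 1} (CDFJLP SODA 2019 Thm 3,
doi:10.1137/1.9781611975482.142; attractor-based algorithms too, arXiv:2001.04333) — achieved from
above
by a MONOTONE CIRCUIT (unrolled lifting, support ParityMonotoneQuasipolyUpper). Cruxes: rank 2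
ParityMonotoneSuperpoly (M1: parity winning regions need superpolynomial monotone circuits), rank 3
MpgMonotoneSuperpoly (M2: same for n-bit mean payoff; implied by M1 via glue ParityToMpg), rank 4
MpgNoMonotoneGap (T-cap: for positional games monotone and general complexity agree up to a
polynomial —
"no Tardos gap for fixed-point problems"), rank 5 ParityMonotoneQuasipolyLower (the sharp
universal-tree
value n^{c log n}). Glue MpgTargetOfCruxes: M2 → T-cap → X.

Rationale: WHY THIS LINE (imports automata/game theory into monotone circuit complexity). The winning-region
functions of
parity and mean-payoff games are monotone in (Even-edges, complemented Odd-edges, weight bits), lie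
in NP ∩ coNP
(UP ∩ coUP, doi:10.1016/s0020-0190(98)00150-1), are P-hard, and are not known to be in P; their
monotone
complexity has a conjectured EXACT value supplied by a theorem of another field: smallest universal
trees are
quasi-polynomial (CDFJLP 2019 Thm 2 = JL17 upper bound 2l·C(lg l + h + 1, h), Thm 3 lower bound
C(lg l + h - 1, h - 1) >= l^{lg(h/lg l) - 1}; read from arXiv:1807.10546 pp. 7-8), and for mean
payoff universal
graphs are pseudo-polynomial (FGO 2020, doi:10.4230/lipics.mfcs.2020.34;
doi:10.46298/lmcs-18(3:29)2022). Unrolled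
progress-measure lifting IS a monotone circuit of size poly(n)|U|^2, so the algorithmic barrier is a
monotone
upper bound; the route bets it is also the monotone truth (M1, M2) and that positional games, unlike
matching
(augmenting paths) or XOR-SAT (Gaussian elimination), hide no cancellation-based algorithm (T-cap).
RANKED CRUXES. #2 ParityMonotoneSuperpoly (any n^{omega(1)} monotone bound for parity games is new
and is the
most checkable statement; engines: dag-like lifting for the monotone KW game of WIN — Alice holds a
game won by
Even with sigma, Bob one won by Odd with tau, play-following finds a differing edge in O(n log n)
bits, a
UEOPL-type search problem —, or approximation with planted-dominion test distributions and the
universal-tree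
counting as the sunflower-type lemma). #3 MpgMonotoneSuperpoly (pseudo-polynomiality: monotone
circuits cannot
subtract; implied by #2 through the monotone projection parity -> mean payoff, glue ParityToMpg). #4
MpgNoMonotoneGap (the transfer; single-function no-gap claim). #5 ParityMonotoneQuasipolyLower
(sharp value).
SUPPORT: ParityMonotoneQuasipolyUpper (S1, provable now: unrolled universal-tree lifting with
indicators
[mu(v) < t]); MpgHardNpLanguage (construction of the NP language; certificate = sigma, verification
= min cycle
mean in G_sigma, Karp); ParityToMpg (Jurdzinski's priority -> weight (-n)^p reduction as a monotone
projection +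
constant elimination GateList.const_or_exists_monotone_circuit + padding); MpgTargetOfCruxes
(arithmetic);
ParityMonotonePoly (negative side: poly-size monotone circuits for all parity templates; kills #2
and #5).
KILL CRITERIA. ParityMonotonePoly proved => #2, #5 dead, route keeps only #3/#4 (re-rank #3 to 2). A
monotone
projection of a known gap function (perfect matching Razborov1985b, Tardos1988's theta-function,
XOR-SAT/CSP with
Gaussian elimination doi:10.4230/LIPIcs.ITCS.2019.38) into poly-size game templates refutes #4 =>
restate #4 in
the max-over-templates form or pivot the transfer to Berkowitz slices (X <=> some Hamming slice of
MPGWIN has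
superpolynomial MONOTONE complexity, Jukna2012 Thm 10.1); MPG in P (poly circuits for all templates)
refutes X and
closes the route (M1/M2 survive as pure monotone questions, to be re-homed).
NOT DECOMPOSED YET (deliberately): the choice of engine for #2 (lifting vs approximation), the
d-ladder (d = 1, 2
poly; d = log^2 n ... n), the slice reformulation of X, discounted/simple-stochastic rungs of the
Zwick-Paterson
chain, and Literature definitions of the games (definition requests filed; items to be restated over
them).
NOVELTY (details in the Novelty field): nearest prior art = universal-tree/graph lower bounds for
the
separation/value-iteration/attractor CLASSES (doi:10.1137/1.9781611975482.142,
doi:10.4230/lipics.mfcs.2020.34,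
arXiv:2001.04333) and games-vs-proof-search (doi:10.1145/2579822, doi:10.1016/j.ic.2011.01.003,
arXiv:1912.03013);
not found: WIN/MPGWIN as monotone Boolean functions, M1/M2, T-cap. Card graded new-combination
twice.
BARRIERS (details in the Barriers field): MonotoneGap/NegationLimitedGap apply squarely to the
transfer and are
turned into crux #4; ApproximationMethodLimit untouched on the monotone basis; NaturalProofs bites
only at X.

Novelty: NOVELTY (search-before-claim 2026-08-15, this planner: `lit search --source crossref` x5 ("universal
trees parity games lower bound", "monotone circuit lower bound parity games mean payoff games",
"Zwick Paterson mean payoff", "Jurdzinski UP co-UP", "Beckmann Pudlak Thapen"), `lit search --hybrid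
--source local` ("monotone circuit parity games mean payoff winning region": only proceedings
volumes, no treatment), `lit galaxy search --star all` ("monotone circuit parity games": 0 rows;
"universal trees": Colcombet–Fijalkow FoSSaCS 2019, Fijalkow optimal value iteration
arXiv:1801.09618), `lit read arxiv:1807.10546` pp. 6-8 (Thms 1-3); plus the card's two refuter
novelty audits (grade new-combination). OpenAlex/arXiv APIs rate-limited (429) during the session;
GKRS ITCS 2019 full text wanted: acq-02082.)
Nearest prior art FOUND: (i) doi:10.1137/1.9781611975482.142 (CDFJLP, SODA 2019) Thm 3 — every
(l,h)-universal tree has >= C(lg l + h - 1, h - 1) >= l^{lg(h/lg l) - 1} leaves — and Thm 2 (=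
Jurdzinski–Lazic 2017 upper bound); doi:10.4230/lipics.mfcs.2020.34 (Fijalkow–Gawrychowski–Ohlmann
2020) and doi:10.46298/lmcs-18(3:29)2022 (universal graphs, pseudo-polynomial for mean payoff);
arXiv:2001.04333 (Jurdzinski–Morvan–Thejaswini: attractor-decomposition algorithms meet the same
bounds): these are the CONJECTURED VALUES of M1/M2, proved only for algorithm classes (separators /
value iteration / universal attractor decompositions), never for monotone circuits. (ii)
doi:10.1145/2579  [refs: 10.1137/1.9781611975482.142, 10.4230/lipics.mfcs.2020.34, 10.46298/lmcs-18(3:29, 10.1145/2579822, 10.1016/j.ic.2011.01.003, 10.4230/LIPIcs.ITCS.2019.38, 1801.09618, 1807.10546, 2001.04333, 1912.03013, arxiv:1807.10546, doi:10.1137/1.9781611975482.142, doi:10.4230/lipics.mfcs.2020.34, doi:10.46298/lmcs-18, doi:10.1145/2579822, doi:10.1016/j.ic.2011.01.003, doi:10.4230/LIPIcs.ITCS.2019.38, Razborov1]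

Barriers (technique_class: monotone-circuit-lower-bounds, approximation-method, games): technique_class: monotone-circuit-lower-bounds, approximation-method, games
- Literature.Barriers.PneNP.MonotoneGap: APPLIES squarely to the transfer step — a monotone lower
bound alone proves nothing about P (perfect matching m^{Omega(log m)}, Razborov1985b; Tardos1988's
theta-function 2^{c v^{1/8}}; MonotoneGap.not_monotoneTransfer_pow refutes every polynomial transfer
for ALL monotone graph functions). NOT evaded in general and not claimed to be: the route asserts
transfer for ONE function family only (crux #4 MpgNoMonotoneGap), justified by the structure of
every known game algorithm (monotone fixed-point iterations; no augmenting-path / cancellation /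
convexity algorithm is known for positional games), and names the cheapest refutation (a monotone
projection of a known gap function into game templates). Fallback outside the barrier's
scope_caveats: Berkowitz slices (Jukna2012 Thm 10.1), where monotone = general up to O(N log^2 N).
- Literature.Barriers.PneNP.NegationLimitedGap: the route uses no negation budget; the multi-output
gap of Jukna2012 Thm 10.21 concerns transfer through r NOT gates, which crux #4 does not invoke (it
is a direct single-function monotone-vs-B2 statement). Recorded because the technique class overlaps
(monotone-to-general-transfer); it adds the warning that gap phenomena persist up to log n - O(log
log n) negations, i.e. #4 cannot be rescued by a small negation budget if it fails.
- Literature.Barriers.PneNP.ApproximationMethodLimit: Razborov 198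

Novelty grade: new-combination — ROUTE REVIEW #3 (refuter 9bf6706f, 2026-08-15): PASS WITH THE SAME ONE OBJECTION — CONCURS with #1 ac84c4a2 and #2 63bb7716 (their briefings on 1292–1302 and #2's proof of glue 1302 stand). Full text: route evidence REVIEW-PositionalGames.md. This pass: 11/11 elaborate by import (W2.lean rc0); encod (refuter refuter-rreview-route-AnomalousDissipati-9bf6706f-0, 2026-08-15T13:40:45Z; prior: doi:10.1137/1.9781611975482.142,doi:10.4230/lipics.mfcs.2020.34,doi:10.1145/2579822,doi:10.1016/j.ic.2011.01.003,arXiv:1912.03013,doi:10.4230/LIPIcs.ITCS.2019.38,doi:10.1007/978-3-031-42354-3,Razborov1985b,Tardos1988,arXiv:1406.3065)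

History (route lifecycle, newest last):
- 2026-08-16T04:14:37Z · AUTO-CRUX (backfill): MpgGeneralSuperpoly — hypotheses of the deciding theorem that nothing in the route derives are cruxes (operator:999:1085951)
- 2026-08-22T03:22:26Z · DORMANT — reconciler: no traction for 5 d (last activity item-evidence-added at 2026-08-17T02:12:13Z); parked, not closed — `ledger route dormant route-PneNP-PositionalGa (operator:999:19745)

sub-problem: PneNP · status: dormant · opened planner-plancard-PneNP-PneNP-positional-games-d04c7d00-0 2026-08-15T10:54:19Z · rev 2 · ledger route-PneNP-PositionalGames
GENERATED by the gate from the ledger (D-0016/17). Provers cite these decls: `theorem foo : Summit.PneNP.PneNP.Theses.PositionalGames.<Decl> := …` in Summits/PneNP/PneNP/Theorems/<Name>.lean.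
-/

namespace Summit.PneNP.PneNP.Theses.PositionalGames

open scoped BigOperators Topology Manifold Classical MeasureTheory ProbabilityTheory Matrix InnerProductSpace ComplexConjugate ContinuousMap
open Filter Set Function TopologicalSpace MeasureTheory

attribute [summit_statement] _root_.PneNP

open Literature.PNP

/-- item stmt-PneNP-1292 · crux (kind.auto-crux: conjecture-grade) · rank 0 · open · by planner
why it might fail: X is false iff MPGWIN has poly-size B2 circuits for all templates, e.g. if MPG ∈ P — live: MPG ∈ UP∩coUP (Jurdzinski1998), pseudo-poly value iteration (ZwickPaterson1996), combinatorial-simplex/LP attacks (AllamigeonEtAl2014), and parity fell to quasi-polynomial time in 2017 (CaludeEtAl2017).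
sources: Jurdzinski1998, ZwickPaterson1996, AllamigeonEtAl2014, CaludeEtAl2017, doi:10.4230/LIPIcs.MFCS.2020.34
[target] Thesis X: threshold MEAN-PAYOFF GAMES with n-bit vertex weights have superpolynomial
GENERAL (B₂) circuit complexity — ∀ k, for infinitely many n some owner template (o, v) needs > n^k
gates (function-level 'MPG ∉ P/poly'). ENCODING (inlined until definitions land; see route header):
owners o : Fin n → Bool (true = Even/Max), start v, priorities p : Fin n → ℕ; bit x(u,w) [x (inl
(u,w))] = 'edge u→w present' if o u = true, 'edge ABSENT' if o u = false ⇒ monotone in x; σ legal :=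
∀ u, o u = true → x(u,σ u) = true; τ legal := ∀ u, o u = false → x(u,τ u) = false; {u | ∃ᶠ t, f^[t]
v = u} (f = σ on Even, τ on Odd vertices) = the cycle of the lasso from v. WIN := ∃ legal σ ∀ legal
τ, max priority on the cycle even; MPGWIN := same with 2^n·|C| ≤ 2·Σ_{u∈C} w u, w u = Σ_j 2^j·x(inr
(u,j)) (cycle mean ≥ 2^(n−1)). = winning region on dead-end-free inputs (positional determinacy); in
general = NoEvenDeadEnd ∧ (SomeOddDeadEnd ∨ W_stuck-loses). Reached by MpgTargetOfCruxes (#3 + #4)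
or, capture-free, via Berkowitz slices (Jukna2012 Thm 10.1; not filed yet).
[doi:10.1016/0304-3975(95)00188-3; doi:10.1016/s0020-0190(98)00150-1] -/
@[route_item "route-PneNP-PositionalGames", crux]
def MpgGeneralSuperpoly : Prop :=
  ∀ k : ℕ, ∃ᶠ n : ℕ in Filter.atTop, ∃ (o : Fin n → Bool) (v : Fin n), n ^ k < Literature.Computability.Complexity.circuitSizeOver Literature.Computability.Complexity.B2 (fun x : (Fin n × Fin n) ⊕ (Fin n × Fin n) → Bool => decide (∃ σ : Fin n → Fin n, (∀ u, o u = true → x (Sum.inl (u, σ u)) = true) ∧ ∀ τ : Fin n → Fin n, (∀ u, o u = false → x (Sum.inl (u, τ u)) = false) → let C : Finset (Fin n) := Finset.univ.filter fun u : Fin n => ∃ᶠ t : ℕ in Filter.atTop, (fun w : Fin n => if o w = true then σ w else τ w)^[t] v = u; 2 ^ n * C.card ≤ 2 * ∑ u ∈ C, ∑ j : Fin n, if x (Sum.inr (u, j)) = true then 2 ^ (j : ℕ) else 0))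

/-- item stmt-PneNP-1294 · crux · rank 2 · open · by planner
why it might fail: Poly monotone circuits for parity contradict nothing: CzerwinskiEtAl2019 Thm 3 / arXiv:2001.04333 bind separators and attractor decompositions, not non-uniform circuits; a uniform-in-the-graph poly resolution/CP refutation of 'σ wins ∧ τ wins' gives them by monotone interpolation (Krajíček 1997).
sources: CzerwinskiEtAl2019, Literature.Combinatorics.Games.OrderedTree.CzerwinskiEtAl2019_universal_lower, arXiv:2001.04333, CaludeEtAl2017, doi:10.1145/2579822, doi:10.2307/2275541
[crux] M1 (weak): 'parity games are not a polynomial MONOTONE problem' — ∀ k, for all large n some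
parity template (o, p, v) on Fin n has winning-region function WIN of monotone complexity (basis
{∧₂,∨₂}, circuitSizeOver monotoneBasis) > n^k. (Encoding as in the route header /
MpgGeneralSuperpoly docstring.) Calibration: unrolled progress-measure lifting over a universal tree
is a monotone circuit of size poly(n)·|U|² = n^{O(log n)} (support ParityMonotoneQuasipolyUpper);
universal trees / universal attractor decompositions need n^{lg(h/lg n)−1}
(doi:10.1137/1.9781611975482.142 Thm 3; arXiv:2001.04333) — for those ALGORITHM classes only.
Engines: (E1) dag-like lifting for the monotone KW game of WIN (play-following finds a differing
edge in O(n log n) bits: a UEOPL-type search problem; monotone size = rectangle-dag size, GKRS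
2019); (E2) approximation with planted-dominion test distributions, universal-tree counting as the
sunflower-type lemma. d = 1, 2 polynomial; interesting range log² n ≤ d ≤ n. Any n^{ω(1)} is new.
Implies #3 via ParityToMpg; negation filed as ParityMonotonePoly. -/
@[route_item "route-PneNP-PositionalGames"]
def ParityMonotoneSuperpoly : Prop :=
  ∀ k : ℕ, ∀ᶠ n : ℕ in Filter.atTop, ∃ (o : Fin n → Bool) (p : Fin n → ℕ) (v : Fin n), n ^ k < Literature.Computability.Complexity.circuitSizeOver Literature.Computability.Complexity.monotoneBasis (fun x : Fin n × Fin n → Bool => decide (∃ σ : Fin n → Fin n, (∀ u, o u = true → x (u, σ u) = true) ∧ ∀ τ : Fin n → Fin n, (∀ u, o u = false → x (u, τ u) = false) → Even ((Finset.univ.filter fun u : Fin n => ∃ᶠ t : ℕ in Filter.atTop, (fun w : Fin n => if o w = true then σ w else τ w)^[t] v = u).sup p)))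

/-- item stmt-PneNP-1295 · crux · rank 3 · open · by planner
why it might fail: Fails iff all MPG templates have poly monotone circuits. Arithmetic alone is no obstruction ([Σaᵢ ≥ t] ∈ mP: digit DP + sorting networks, evidence on 1296); pseudo-poly lower bounds bind only universal-graph/value-iteration algorithms (FGO 2020); a bit-scaling scheme poly in log W unrolls to them.
sources: doi:10.4230/LIPIcs.MFCS.2020.34, ColcombetEtAl2021, ZwickPaterson1996, Jurdzinski1998, JuknaSeiwertSergeev2022
[crux] M2: threshold mean-payoff games with n-bit weights need superpolynomial MONOTONE circuits — ∀
k, for all large n some template (o, v) has circuitSizeOver monotoneBasis (MPGWIN n o v) > n^k.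
(Encoding as in the route header / MpgGeneralSuperpoly docstring.) Calibration: unrolled value
iteration gives monotone size poly(n)·W = poly(n)·2^n only; universal graphs for mean payoff are
provably pseudo-polynomial for the value-iteration/separation class (FGO 2020
doi:10.4230/lipics.mfcs.2020.34; doi:10.46298/lmcs-18(3:29)2022); no poly-size monotone circuit is
known, matching the absence of any (quasi- /strongly-)polynomial algorithm. Engine E3: weights enter
monotonically bit by bit, so a monotone circuit must compare cycle sums Σ w(C) selected by edge
literals without subtracting ((min,+) core; Jerrum–Snir-type tropical bounds). Implied by #2 via the
monotone projection of Jurdziński's reduction (glue ParityToMpg), hence at least as safe as #2; with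
#4 gives X (MpgTargetOfCruxes). -/
@[route_item "route-PneNP-PositionalGames"]
def MpgMonotoneSuperpoly : Prop :=
  ∀ k : ℕ, ∀ᶠ n : ℕ in Filter.atTop, ∃ (o : Fin n → Bool) (v : Fin n), n ^ k < Literature.Computability.Complexity.circuitSizeOver Literature.Computability.Complexity.monotoneBasis (fun x : (Fin n × Fin n) ⊕ (Fin n × Fin n) → Bool => decide (∃ σ : Fin n → Fin n, (∀ u, o u = true → x (Sum.inl (u, σ u)) = true) ∧ ∀ τ : Fin n → Fin n, (∀ u, o u = false → x (Sum.inl (u, τ u)) = false) → let C : Finset (Fin n) := Finset.univ.filter fun u : Fin n => ∃ᶠ t : ℕ in Filter.atTop, (fun w : Fin n => if o w = true then σ w else τ w)^[t] v = u; 2 ^ n * C.card ≤ 2 * ∑ u ∈ C, ∑ j : Fin n, if x (Sum.inr (u, j)) = true then 2 ^ (j : ℕ) else 0))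

/-- item stmt-PneNP-1296 · crux · rank 4 · open · by planner
why it might fail: Its ∀-templates includes ONE-PLAYER arenas (o constant), where F = binary-weight min/max-mean-cycle threshold ∈ P (Karp1978): T-cap asserts poly MONOTONE circuits for this (min,+)-type function, only pseudo-poly known; a Tardos-type gap there (Razborov1985b, Tardos1988) kills it, no game content.
sources: Karp1978, Razborov1985b, Tardos1988, GoosKamathRobereSokolov2019, Literature.Barriers.PneNP.MonotoneGap, AllamigeonEtAl2014
[crux] T-cap, 'no Tardos gap for fixed-point problems': ∃ c, for all large n and EVERY mean-payoff
template (o, v): circuitSizeOver monotoneBasis F ≤ n^c·(circuitSizeOver B2 F)^c, F = MPGWIN n o v.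
(Encoding as in the route header / MpgGeneralSuperpoly docstring.) Why believe it: every algorithm
ever designed for these games (attractors, progress measures, strategy improvement — evaluation is a
(min,+) shortest path, switching a threshold —, separating automata, quasi-dominions) is a monotone
fixed-point iteration and unrolls to a monotone circuit; all KNOWN gaps come from augmenting paths
(perfect matching, Razborov1985b), convex optimisation (Tardos1988, ϑ) or Gaussian elimination
(XOR-SAT, GKRS 2019), structures positional games are not known to have. This is the step
Literature.Barriers.PneNP.MonotoneGap forbids in general, asserted for ONE function family. FASTEST
REFUTATION: a monotone projection of a known gap function (PM, Tardos, affine CSP, OddFactor) into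
poly-size game templates. Repair if refuted: max-over-templates form (∀ o v ∃ o' v', mSIZE(F o v) ≤
n^c·SIZE_B2(F o' v')^c — all the glue needs) or Berkowitz slices. -/
@[route_item "route-PneNP-PositionalGames"]
def MpgNoMonotoneGap : Prop :=
  ∃ c : ℕ, ∀ᶠ n : ℕ in Filter.atTop, ∀ (o : Fin n → Bool) (v : Fin n), let F : ((Fin n × Fin n) ⊕ (Fin n × Fin n) → Bool) → Bool := fun x => decide (∃ σ : Fin n → Fin n, (∀ u, o u = true → x (Sum.inl (u, σ u)) = true) ∧ ∀ τ : Fin n → Fin n, (∀ u, o u = false → x (Sum.inl (u, τ u)) = false) → let C : Finset (Fin n) := Finset.univ.filter fun u : Fin n => ∃ᶠ t : ℕ in Filter.atTop, (fun w : Fin n => if o w = true then σ w else τ w)^[t] v = u; 2 ^ n * C.card ≤ 2 * ∑ u ∈ C, ∑ j : Fin n, if x (Sum.inr (u, j)) = true then 2 ^ (j : ℕ) else 0); Literature.Computability.Complexity.circuitSizeOver Literature.Computability.Complexity.monotoneBasis F ≤ n ^ c * Literature.Computability.Complexity.circuitSizeOver Literature.Computability.Complexity.B2 F ^ c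

/-- item stmt-PneNP-1297 · crux · rank 5 · open · by planner
why it might fail: n^{c log n} is proved only for universal trees/separators (CzerwinskiEtAl2019 Thm 3), attractor decompositions (arXiv:2001.04333) and universal-tree strategy iteration (Koh–Loho 2025); a non-uniform monotone circuit need be none of these: any growth like n^{O(√log n)} refutes #5 with #2 intact.
sources: CzerwinskiEtAl2019, Literature.Combinatorics.Games.OrderedTree.CzerwinskiEtAl2019_universal_lower, Literature.Combinatorics.Games.OrderedTree.JurdzinskiLazic2017_universal, arXiv:2001.04333, doi:10.46298/lmcs-21(2:24)2025, arXiv:1807.10546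
[crux] M1 sharp, 'universal trees are the monotone truth about parity games': ∃ c > 0, for all large
n some parity template on Fin n has monotone complexity ≥ n^{c·log n} — the universal-tree value for
h ~ n/2 (CDFJLP Thm 3: ℓ^{lg(h/lg ℓ)−1} = n^{lg n − lg lg n − O(1)} for separators; Thm 2 and
support ParityMonotoneQuasipolyUpper give the matching n^{O(log n)} monotone upper bound). (Encoding
as in the route header / MpgGeneralSuperpoly docstring.) Stated over ℝ like
Literature.Barriers.PneNP.Razborov1985b_perfectMatching. Strengthens #2. A proof would recast the
2017–2022 quasi-polynomial barrier as a circuit lower bound; a refutation with #2 intact (n^{ω(1)}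
but n^{o(log n)}) would be the first evidence that non-uniformity beats universal trees.
[doi:10.1137/1.9781611975482.142; arXiv:1807.10546 pp. 7–8] -/
@[route_item "route-PneNP-PositionalGames"]
def ParityMonotoneQuasipolyLower : Prop :=
  ∃ c : ℝ, 0 < c ∧ ∀ᶠ n : ℕ in Filter.atTop, ∃ (o : Fin n → Bool) (p : Fin n → ℕ) (v : Fin n), (n : ℝ) ^ (c * Real.log n) ≤ (Literature.Computability.Complexity.circuitSizeOver Literature.Computability.Complexity.monotoneBasis (fun x : Fin n × Fin n → Bool => decide (∃ σ : Fin n → Fin n, (∀ u, o u = true → x (u, σ u) = true) ∧ ∀ τ : Fin n → Fin n, (∀ u, o u = false → x (u, τ u) = false) → Even ((Finset.univ.filter fun u : Fin n => ∃ᶠ t : ℕ in Filter.atTop, (fun w : Fin n => if o w = true then σ w else τ w)^[t] v = u).sup p))) : ℝ)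

/-- item stmt-PneNP-1298 · support · rank 9 · closed · proved by Summit.PneNP.PneNP.Theorems.ParityMonotoneQuasipolyUpper_proof (prover) · by planner
[support] S1: quasi-polynomial monotone UPPER bound for EVERY parity template, circuitSizeOver
monotoneBasis (WIN n o p v) ≤ n^{c·log₂ n + c}. (Encoding as in the route header /
MpgGeneralSuperpoly docstring.) Provable now: lifting over an (n,h)-universal tree U (Jurdziński
2000; JL17 = CDFJLP Thm 2, |U| ≤ 2ℓ·C(⌈lg ℓ⌉+h+1,h) = ℓ^{lg h+O(1)}, h ≤ n) computes the least
progress measure μ; encode μ by indicators [μ(u) < t] (MONOTONE in the input; [μ ≥ t] is antitone),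
start all-true, ≤ n(|U|+1) rounds, each ∧/∨ of edge literals and previous indicators (Even u: ⋁_w
x(u,w) ∧ [μ w < g_p(t)]; Odd u: ⋀_w (x(u,w) ∨ [μ w < g_p(t)])): size O(n³|U|²) = n^{2lg n+O(1)}.
This computes the stuck-loses region W; the item's function is NoEvenDeadEnd ∧ (SomeOddDeadEnd ∨ W)
(+2n² gates). Needs 'Even wins iff a progress measure exists' (Emerson–Jutla / Jurdziński = CDFJLP
Thm 1; cite item filed). Junk value 0 only helps. [arXiv:1807.10546 Thms 1–2] -/
@[route_item "route-PneNP-PositionalGames"]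
def ParityMonotoneQuasipolyUpper : Prop :=
  ∃ c : ℕ, ∀ᶠ n : ℕ in Filter.atTop, ∀ (o : Fin n → Bool) (p : Fin n → ℕ) (v : Fin n), Literature.Computability.Complexity.circuitSizeOver Literature.Computability.Complexity.monotoneBasis (fun x : Fin n × Fin n → Bool => decide (∃ σ : Fin n → Fin n, (∀ u, o u = true → x (u, σ u) = true) ∧ ∀ τ : Fin n → Fin n, (∀ u, o u = false → x (u, τ u) = false) → Even ((Finset.univ.filter fun u : Fin n => ∃ᶠ t : ℕ in Filter.atTop, (fun w : Fin n => if o w = true then σ w else τ w)^[t] v = u).sup p))) ≤ n ^ (c * Nat.log 2 n + c)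

/-- item stmt-PneNP-1299 · support · rank 9 · open · by planner
[support] NEGATIVE SIDE, kill switch for #2/#5: polynomial-size MONOTONE circuits for all parity
templates — ∃ k, ∀ᶠ n, ∀ o p v, circuitSizeOver monotoneBasis (WIN n o p v) ≤ n^k ('parity games ∈
monotone P/poly'). (Encoding as in the route header / MpgGeneralSuperpoly docstring.) Would be major
news (a non-uniform monotone scheme beating the separator bound doi:10.1137/1.9781611975482.142 Thm
3, and parity games in non-uniform P). Filed so the refuting direction of the rank-2 crux is a
citable statement; if proved the route drops #2/#5 and re-ranks #3 to 2. -/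
@[route_item "route-PneNP-PositionalGames", crux]
def ParityMonotonePoly : Prop :=
  ∃ k : ℕ, ∀ᶠ n : ℕ in Filter.atTop, ∀ (o : Fin n → Bool) (p : Fin n → ℕ) (v : Fin n), Literature.Computability.Complexity.circuitSizeOver Literature.Computability.Complexity.monotoneBasis (fun x : Fin n × Fin n → Bool => decide (∃ σ : Fin n → Fin n, (∀ u, o u = true → x (u, σ u) = true) ∧ ∀ τ : Fin n → Fin n, (∀ u, o u = false → x (u, τ u) = false) → Even ((Finset.univ.filter fun u : Fin n => ∃ᶠ t : ℕ in Filter.atTop, (fun w : Fin n => if o w = true then σ w else τ w)^[t] v = u).sup p))) ≤ n ^ k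

/-- item stmt-PneNP-1300 · support · rank 9 · closed · proved by Summit.PneNP.PneNP.Theorems.mpgHardNpLanguage_proof @ 13c61e86a2e9 (prover) · by planner
[support] CONSTRUCTION carrying X to the summit: ∃ L : Language Bool, L ∈ NP ∧ (L ∈ PPoly → ∃ c, ∀ᶠ
n, ∀ o v, circuitSizeOver B2 (MPGWIN n o v) ≤ n^c). (Encoding as in the route header /
MpgGeneralSuperpoly docstring.) Witness: L = {enc(n,o,v,x) : MPGWIN n o v x}, owner bits, start
vertex and the 2n² game bits all in the input (injective length N(n)). (a) L ∈ NP: certificate σ;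
verifier checks σ legal, accepts if some Odd vertex has no legal edge (∀τ vacuous), else computes
the min cycle mean reachable from v in G_σ (Even follows σ, Odd keeps all legal edges; every
reachable simple cycle is realised by a legal positional τ) by Karp / Bellman–Ford and compares with
2^(n−1) — no determinacy needed, the function is DEFINED in ∃σ∀τ form. (b) a size-p(N) B₂ family for
L, at length N(n) with o-, v-bits hard-wired (Circuit.exists_restrict, Circuit.mapInputs:
CircuitRestriction.lean, CircuitInputMap.lean), is a B₂ circuit for x ↦ MPGWIN n o v x of size ≤
n^c. TM work as in KarpCliqueNP.lean. -/
@[route_item "route-PneNP-PositionalGames", crux]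
def MpgHardNpLanguage : Prop :=
  ∃ L : Language Bool, L ∈ Literature.Computability.Complexity.Nondeterministic.NP ∧ (L ∈ Literature.Computability.Complexity.PPoly → ∃ c : ℕ, ∀ᶠ n : ℕ in Filter.atTop, ∀ (o : Fin n → Bool) (v : Fin n), Literature.Computability.Complexity.circuitSizeOver Literature.Computability.Complexity.B2 (fun x : (Fin n × Fin n) ⊕ (Fin n × Fin n) → Bool => decide (∃ σ : Fin n → Fin n, (∀ u, o u = true → x (Sum.inl (u, σ u)) = true) ∧ ∀ τ : Fin n → Fin n, (∀ u, o u = false → x (Sum.inl (u, τ u)) = false) → let C : Finset (Fin n) := Finset.univ.filter fun u : Fin n => ∃ᶠ t : ℕ in Filter.atTop, (fun w : Fin n => if o w = true then σ w else τ w)^[t] v = u; 2 ^ n * C.card ≤ 2 * ∑ u ∈ C, ∑ j : Fin n, if x (Sum.inr (u, j)) = true then 2 ^ (j : ℕ) else 0)) ≤ n ^ c)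

/-- item stmt-PneNP-1301 · support · rank 9 · closed · proved by Summit.PneNP.PneNP.Theorems.parityToMpg_proof (prover) · by planner
[support] GLUE S4: ParityMonotoneSuperpoly → MpgMonotoneSuperpoly. (i) Compress the ≤ n priorities
to {0..2n} keeping order and parity; (ii) Jurdziński's reduction
(doi:10.1016/s0020-0190(98)00150-1): weight w(u) = 2^{m−1} + (−1)^{p(u)}·n^{p(u)} in an m-vertex
mean-payoff template, m = poly(n): on a cycle the top-priority term dominates, so mean ≥ 2^{m−1} iff
the max priority is even; (iii) a MONOTONE PROJECTION: edge bits of embedded vertices copied (same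
owners), weight bits and all bits of padding vertices constants (padding vertices: present
self-loop, no incoming edges ⇒ global legality intact, unreachable); (iv) a monotone circuit for
MPGWIN m with inputs fixed to constants is a {∧,∨,0,1} circuit; constant elimination
(GateList.const_or_exists_monotone_circuit, NegationElimination.lean) gives a {∧,∨} circuit no
larger unless the function is constant — excluded since n^k < mSIZE(WIN); (v) padding m ↦ m+1 makes
hardness along m = m(n) hardness for all large m with polynomial loss. [Jukna2012 §1.4 projections] -/
@[route_item "route-PneNP-PositionalGames"]
def ParityToMpg : Prop :=
  ParityMonotoneSuperpoly → MpgMonotoneSuperpoly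

/-- item stmt-PneNP-1302 · support · rank 9 · closed · proved by Summit.PneNP.PneNP.Theorems.mpgTargetOfCruxes_proof @ 141c5e4fb5a7 (prover) · by planner
[support] GLUE: MpgMonotoneSuperpoly → MpgNoMonotoneGap → MpgGeneralSuperpoly. Arithmetic: n^{k'} <
mSIZE(F) ≤ n^c·SIZE_B2(F)^c eventually, with k' = c(k+1), forces SIZE_B2(F) > n^k eventually, hence
frequently (Filter.Eventually.frequently). Elementary. -/
@[route_item "route-PneNP-PositionalGames"]
def MpgTargetOfCruxes : Prop :=
  MpgMonotoneSuperpoly → MpgNoMonotoneGap → MpgGeneralSuperpoly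

/-- item stmt-PneNP-1293 · assembly · rank 1 · closed · proved by Summit.PneNP.PneNP.Theorems.positionalGames_assembly_proof @ 50c43a44eac0 (prover) · by planner
[assembly] X → PneNP given the constructed language: MpgHardNpLanguage supplies L ∈ NP (CplxCore)
non-uniformly as hard as every mean-payoff template; if PneNP failed, every L ∈ NP Bool would lie in
P Bool, so by P_bool_eq_holds / NP_bool_eq_holds / P_subset_PPoly_holds (all PROVED) L ∈ PPoly,
giving ∃ c, ∀ᶠ n, ∀ o v, circuitSizeOver B2 (MPGWIN n o v) ≤ n^c, contradicting X
(Frequently.and_eventually). Elementary; checked in the planner's Sketch.lean. [AroraBarak2009 Thm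
6.6] -/
@[route_item "route-PneNP-PositionalGames"]
def Assembly : Prop :=
  MpgMonotoneSuperpoly → MpgNoMonotoneGap → MpgHardNpLanguage → PneNP

/-! D-0027 §2.1 — DECIDING THEOREM (planner-authored via `route open/edit --closes-file`; by planner-rbadge-PneNP-PositionalGames-cf82cece-g2-0 2026-08-15T16:20:11Z):
its hypotheses are this route's items and its conclusion the sub-problem Statement (glue_lint), and it elaborates with this file. -/

@[closes "route-PneNP-PositionalGames"] theorem closes (hX : MpgGeneralSuperpoly) (hL : MpgHardNpLanguage) : PneNP := by
  classical
  by_contra hne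
  obtain ⟨L, hLNP, hLimp⟩ := hL
  -- model bridge NP (Cook, Option Bool checking relations) = NP (CplxCore certificates): proved fact
  have hNP' : L ∈ Literature.Computability.Complexity.PNPWave0.NP Bool := by
    rw [Literature.Computability.Complexity.np_bool_eq]; exact hLNP
  -- if PneNP failed, L would be in Cook's P
  have hP : L ∈ Literature.Computability.Complexity.PNPWave0.P Bool := by
    by_contra hnotP
    apply hne
    unfold PneNP Literature.PNP.PNeNP
    exact ⟨L, hNP', hnotP⟩
  -- model bridge P Bool = Classes.P (proved) and P ⊆ P/poly (Arora–Barak Thm 6.6, proved)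
  have hP2 : L ∈ Literature.Computability.Complexity.Classes.P := by
    have e := Literature.Computability.Complexity.P_bool_eq_holds
    unfold Literature.Computability.Complexity.P_bool_eq at e
    rw [← e]; exact hP
  have hPPoly : L ∈ Literature.Computability.Complexity.PPoly :=
    Literature.Computability.Complexity.P_subset_PPoly_holds hP2
  -- polynomial circuits for every mean-payoff template, eventually
  obtain ⟨c, hc⟩ := hLimp hPPoly
  -- versus X at exponent c: frequently some template needs more than n^c gates
  obtain ⟨n, ⟨o, v, hlt⟩, hle⟩ := ((hX c).and_eventually hc).exists
  exact absurd (hle o v) (not_le.mpr hlt)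

end Summit.PneNP.PneNP.Theses.PositionalGames
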